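import Summits.QuantumFields.YangMills.Theorems.FlatTubeReductionPolyakovPairSeparation
import Summits.QuantumFields.YangMills.Theorems.FlatTubeReductionPowerSeparation
import Summits.QuantumFields.YangMills.Theorems.LuscherReductionRunningReductionInnerCopiesForm
import Summits.QuantumFields.YangMills.Theorems.LuscherReductionTwistedTraceScalingBTPointwise
import HarnessLib

/-!
# FAR slow pairs: both the one-site kernel `K̃₁^{(B)}(u,u')` and the BO kernel `𝒦_β(u,u')` are Gaussian-small — `≤ crossBound` of the separation — the K-far estimate of hT at rate
# in its deterministic form
# (route `FlatTubeReduction`, crux K1 `NearFlatRatioLaw` stmt-QuantumFields-24720; seat `ym-line-ftr-p1` g14; rate twin «ratepack-v3 / frozen fibres»; R2b1 RECORD rung — no summit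
# statement is proved here)

WHY (memo `Cruxes/NearFlatRatioLaw/Lines/ratepack-v3-frozen-g12.md` §8.3).  A slow pair `(u,u')` is FAR when `Σ_k ‖u_k − c·u'_k·c⁻¹‖_F ≥ m` for every colour rotation `c`.  Then every
one-site gauge image of `u'` is `m`-far from `u`, so RED's cross bound gives `K̃₁^{(B)}(u,u') ≤ crossBound 1 B m = e^{6B}e^{−Bm²/6}`; and every lattice gauge image of a tube fibre
`orthoTube u' v'` is `(L³(1 − (L−1)δ)m − 12L³(r + r'))`-far from `orthoTube u v` (`…PolyakovPairSeparation` + `…PowerSeparation`), so the gauge-averaged lattice kernel between the two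
fibres, hence the BO kernel `𝒦_β(u,u') = ∫∫ Ω Ω' K̃_β`, is `≤ crossBound L β (…)`:
* `avgKernel_le_of_forall_gauge`;  ★ `avgKernel_one_site_far_le`;  `far_sum_links_of_polyakov`;  ★ `avgKernel_orthoTube_far_le`;  ★★ `abs_boKernel_far_le`.
HONEST FRAMING: deterministic kernel bounds; turning them into the `θ = O(λ_b²)·c·λ₀` slack of `tubeForm_boFun_near_of_nearFar` (choice `m ≍ √(log(L³β)/(L³β))`, normalisation of `c`)
and the NEAR-pair estimate remain; femto rung R2b1 (RECORD label); not infinite volume, not a gap, not Clay.  No defs, no named facts, no `sorry`.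
-/

set_option autoImplicit false

noncomputable section

open MeasureTheory Filter Topology Real
open scoped BigOperators
open Literature.MathematicalPhysics.QuantumFieldTheory
open Literature.MathematicalPhysics.QuantumLattice

namespace Summit.QuantumFields.YangMills.Theorems.FemtoTransferGap.TwoLattice.ConstTube

open Summit.QuantumFields.YangMills.Theorems.FemtoTransferGap
open Summit.QuantumFields.YangMills.Theorems.FemtoTransferGap.TwoLattice.Avg
open Summit.QuantumFields.YangMills.Theorems.FemtoTransferGap.TwoLattice.Stiff (LinkSpace)

variable {L : ℕ} [NeZero L]

/-! ## §1 The one-site kernel on far pairs -/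

/-- `K̃_β(U,V) ≤ M` as soon as `K_β(U, V^g) ≤ M` for every gauge transformation `g` (probability average). [folklore] -/
theorem avgKernel_le_of_forall_gauge {M₀ : ℕ} [NeZero M₀] (β : ℝ) {M : ℝ} (U V : GaugeConfig 3 M₀ SU2)
    (hM : ∀ g : Site 3 M₀ → SU2, transferKernel su2Rep β U (gaugeTransform g V) ≤ M) : avgKernel β U V ≤ M := by
  unfold avgKernel
  have h := integral_mono (integrable_transferKernel_gaugeTransform_right β U V) (integrable_const M) fun g => hM g
  simpa [integral_const] using h

/-- ★ **The one-site kernel on a far pair**: if `Σ_e ‖u_e − c·u'_e·c⁻¹‖_F ≥ m ≥ 0` for every `c ∈ SU(2)`, then `K̃₁^{(B)}(u,u') ≤ crossBound 1 B m` (`B ≥ 0`). [folklore] -/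
theorem avgKernel_one_site_far_le {B : ℝ} (hB : 0 ≤ B) {m : ℝ} (hm : 0 ≤ m) (u u' : GaugeConfig 3 1 SU2)
    (hfar : ∀ c : SU2, m ≤ ∑ e : Edge 3 1, frobNorm (((u e : SU2) : Matrix (Fin 2) (Fin 2) ℂ) - ((c * u' e * c⁻¹ : SU2) : Matrix (Fin 2) (Fin 2) ℂ))) :
    avgKernel B u u' ≤ crossBound 1 B m := by
  refine avgKernel_le_of_forall_gauge B u u' fun g => transferKernel_le_crossBound hB hm ?_
  rw [gaugeTransform_one_site_eq_const g u']
  simpa only [gaugeTransform_const_apply] using hfar (g 0)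

/-! ## §2 Tube fibres over far pairs -/

/-- **Far slow pairs have far fibres**: `U = orthoTube u v`, `V = orthoTube u' v'` (`‖v_e‖ ≤ r ≤ ½`, `‖v'_e‖ ≤ r' ≤ ½`), slow links within `δ` of `1`, and
`Σ_k ‖u_k − c u'_k c⁻¹‖_F ≥ m` for all `c`; then for every lattice gauge transformation `g`:
`L³(1 − (L−1)δ)·m − 12L³(r + r') ≤ Σ_e ‖U_e − (V^g)_e‖_F`. [folklore] -/
theorem far_sum_links_of_polyakov (u u' : GaugeConfig 3 1 SU2) {v v' : Edge 3 L → Fin 3 → ℝ} {r r' : ℝ} (hr : r ≤ 1 / 2) (hv : ∀ e, ‖v e‖ ≤ r)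
    (hr' : r' ≤ 1 / 2) (hv' : ∀ e, ‖v' e‖ ≤ r') {δ : ℝ} (hu : ∀ k : Fin 3, frobNorm (((u (0, k) : SU2) : Matrix (Fin 2) (Fin 2) ℂ) - 1) ≤ δ)
    (hu' : ∀ k : Fin 3, frobNorm (((u' (0, k) : SU2) : Matrix (Fin 2) (Fin 2) ℂ) - 1) ≤ δ) (hLδ : ((L : ℝ) - 1) * δ ≤ 1) {m : ℝ}
    (hfar : ∀ c : SU2, m ≤ ∑ k : Fin 3, frobNorm (((u (0, k) : SU2) : Matrix (Fin 2) (Fin 2) ℂ) - ((c * u' (0, k) * c⁻¹ : SU2) : Matrix (Fin 2) (Fin 2) ℂ)))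
    (g : Site 3 L → SU2) :
    (L : ℝ) ^ 3 * (1 - ((L : ℝ) - 1) * δ) * m - 12 * (L : ℝ) ^ 3 * (r + r') ≤
      ∑ e : Edge 3 L, frobNorm (((orthoTube L u v e : SU2) : Matrix (Fin 2) (Fin 2) ℂ) - ((gaugeTransform g (orthoTube L u' v') e : SU2) : Matrix (Fin 2) (Fin 2) ℂ)) := by
  obtain ⟨x, hx⟩ := exists_site_conj_powers_le (L := L) u u' hr hv hr' hv' g
  have hL0 : (0 : ℝ) ≤ L := Nat.cast_nonneg _
  have hfac : 0 ≤ 1 - ((L : ℝ) - 1) * δ := by linarith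
  -- per direction: `L(1 − (L−1)δ)‖u_k − c u'_k c⁻¹‖ ≤ ‖u_k^L − c u'_k^L c⁻¹‖`
  have hk : ∀ k : Fin 3, (L : ℝ) * (1 - ((L : ℝ) - 1) * δ) * frobNorm (((u (0, k) : SU2) : Matrix (Fin 2) (Fin 2) ℂ) - ((g x * u' (0, k) * (g x)⁻¹ : SU2) : Matrix (Fin 2) (Fin 2) ℂ)) ≤
      frobNorm (((u (0, k) ^ L : SU2) : Matrix (Fin 2) (Fin 2) ℂ) - ((g x * u' (0, k) ^ L * (g x)⁻¹ : SU2) : Matrix (Fin 2) (Fin 2) ℂ)) :=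
    fun k => frobNorm_pow_sub_conj_pow_ge (u (0, k)) (u' (0, k)) (g x) (hu k) (hu' k) L
  have hsum : (L : ℝ) * (1 - ((L : ℝ) - 1) * δ) * m ≤
      ∑ k : Fin 3, frobNorm (((u (0, k) ^ L : SU2) : Matrix (Fin 2) (Fin 2) ℂ) - ((g x * u' (0, k) ^ L * (g x)⁻¹ : SU2) : Matrix (Fin 2) (Fin 2) ℂ)) := by
    calc (L : ℝ) * (1 - ((L : ℝ) - 1) * δ) * m
        ≤ (L : ℝ) * (1 - ((L : ℝ) - 1) * δ) * ∑ k : Fin 3, frobNorm (((u (0, k) : SU2) : Matrix (Fin 2) (Fin 2) ℂ) - ((g x * u' (0, k) * (g x)⁻¹ : SU2) : Matrix (Fin 2) (Fin 2) ℂ)) :=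
          mul_le_mul_of_nonneg_left (hfar (g x)) (mul_nonneg hL0 hfac)
      _ = ∑ k : Fin 3, (L : ℝ) * (1 - ((L : ℝ) - 1) * δ) * frobNorm (((u (0, k) : SU2) : Matrix (Fin 2) (Fin 2) ℂ) - ((g x * u' (0, k) * (g x)⁻¹ : SU2) : Matrix (Fin 2) (Fin 2) ℂ)) := by
          rw [Finset.mul_sum]
      _ ≤ _ := Finset.sum_le_sum fun k _ => hk k
  have h2 := mul_le_mul_of_nonneg_left hsum (sq_nonneg (L : ℝ))
  nlinarith [hx, h2]

/-- ★ **The gauge-averaged lattice kernel between fibres over a far pair**: with the data of `far_sum_links_of_polyakov`, `β ≥ 0` and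
`m_L = L³(1 − (L−1)δ)m − 12L³(r + r') ≥ 0`: `K̃_β(orthoTube u v, orthoTube u' v') ≤ crossBound L β m_L`. [folklore] -/
theorem avgKernel_orthoTube_far_le {β : ℝ} (hβ : 0 ≤ β) (u u' : GaugeConfig 3 1 SU2) {v v' : Edge 3 L → Fin 3 → ℝ} {r r' : ℝ} (hr : r ≤ 1 / 2)
    (hv : ∀ e, ‖v e‖ ≤ r) (hr' : r' ≤ 1 / 2) (hv' : ∀ e, ‖v' e‖ ≤ r') {δ : ℝ} (hu : ∀ k : Fin 3, frobNorm (((u (0, k) : SU2) : Matrix (Fin 2) (Fin 2) ℂ) - 1) ≤ δ)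
    (hu' : ∀ k : Fin 3, frobNorm (((u' (0, k) : SU2) : Matrix (Fin 2) (Fin 2) ℂ) - 1) ≤ δ) (hLδ : ((L : ℝ) - 1) * δ ≤ 1) {m : ℝ}
    (hfar : ∀ c : SU2, m ≤ ∑ k : Fin 3, frobNorm (((u (0, k) : SU2) : Matrix (Fin 2) (Fin 2) ℂ) - ((c * u' (0, k) * c⁻¹ : SU2) : Matrix (Fin 2) (Fin 2) ℂ)))
    (hmL : 0 ≤ (L : ℝ) ^ 3 * (1 - ((L : ℝ) - 1) * δ) * m - 12 * (L : ℝ) ^ 3 * (r + r')) :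
    avgKernel β (orthoTube L u v) (orthoTube L u' v') ≤ crossBound L β ((L : ℝ) ^ 3 * (1 - ((L : ℝ) - 1) * δ) * m - 12 * (L : ℝ) ^ 3 * (r + r')) :=
  avgKernel_le_of_forall_gauge β _ _ fun g => transferKernel_le_crossBound hβ hmL (far_sum_links_of_polyakov u u' hr hv hr' hv' hu hu' hLδ hfar g)

/-! ## §3 ★★ The BO kernel on far pairs -/

/-- ★★ **The BO kernel on a far pair**: for a profile `Ω` with `|Ω| ≤ C_Ω` supported in `‖x‖ ≤ r ≤ ½`, slow links within `δ` of `1` (`(L−1)δ ≤ 1`), `β ≥ 0`, a far pair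
(`Σ_k ‖u_k − c u'_k c⁻¹‖_F ≥ m` for all `c`) and `m_L = L³(1 − (L−1)δ)m − 24L³r ≥ 0`:  `|𝒦_β(u,u')| ≤ C_Ω²·π(univ)²·crossBound L β m_L`. [cite: Luscher1983, §3] -/
theorem abs_boKernel_far_le {β : ℝ} (hβ : 0 ≤ β) {Ω : LinkSpace L → ℝ} {CΩ : ℝ} (hCΩ : ∀ x, |Ω x| ≤ CΩ) {r : ℝ} (hr : r ≤ 1 / 2) (hΩr : ∀ x, Ω x ≠ 0 → ‖x‖ ≤ r)
    (u u' : GaugeConfig 3 1 SU2) {δ : ℝ} (hu : ∀ k : Fin 3, frobNorm (((u (0, k) : SU2) : Matrix (Fin 2) (Fin 2) ℂ) - 1) ≤ δ)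
    (hu' : ∀ k : Fin 3, frobNorm (((u' (0, k) : SU2) : Matrix (Fin 2) (Fin 2) ℂ) - 1) ≤ δ) (hLδ : ((L : ℝ) - 1) * δ ≤ 1) {m : ℝ}
    (hfar : ∀ c : SU2, m ≤ ∑ k : Fin 3, frobNorm (((u (0, k) : SU2) : Matrix (Fin 2) (Fin 2) ℂ) - ((c * u' (0, k) * c⁻¹ : SU2) : Matrix (Fin 2) (Fin 2) ℂ)))
    (hmL : 0 ≤ (L : ℝ) ^ 3 * (1 - ((L : ℝ) - 1) * δ) * m - 12 * (L : ℝ) ^ 3 * (r + r)) :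
    |boKernel L β Ω u u'| ≤ CΩ ^ 2 * (orthoTransverse L).real Set.univ ^ 2 * crossBound L β ((L : ℝ) ^ 3 * (1 - ((L : ℝ) - 1) * δ) * m - 12 * (L : ℝ) ^ 3 * (r + r)) := by
  haveI := isFiniteMeasure_orthoTransverse L
  have hCΩ0 : 0 ≤ CΩ := (abs_nonneg _).trans (hCΩ 0)
  set X : ℝ := crossBound L β ((L : ℝ) ^ 3 * (1 - ((L : ℝ) - 1) * δ) * m - 12 * (L : ℝ) ^ 3 * (r + r)) with hX
  have hX0 : 0 ≤ X := (crossBound_pos (L := L) β _).le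
  set P : ℝ := (orthoTransverse L).real Set.univ with hP
  have hP0 : 0 ≤ P := measureReal_nonneg
  -- on the support: `‖v_e‖ ≤ r`
  have hve : ∀ w : Edge 3 L → Fin 3 → ℝ, Ω (linkEmbed L w) ≠ 0 → ∀ e, ‖w e‖ ≤ r := fun w hw e => (norm_apply_le_norm_linkEmbed w e).trans (hΩr _ hw)
  have hK : ∀ v v' : Edge 3 L → Fin 3 → ℝ, Ω (linkEmbed L v) ≠ 0 → Ω (linkEmbed L v') ≠ 0 → avgKernel β (orthoTube L u v) (orthoTube L u' v') ≤ X :=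
    fun v v' h1 h2 => avgKernel_orthoTube_far_le hβ u u' hr (hve v h1) hr (hve v' h2) hu hu' hLδ hfar hmL
  -- the inner integral over the support of `Ω(v̂)`
  have hinner : ∀ v : Edge 3 L → Fin 3 → ℝ, Ω (linkEmbed L v) ≠ 0 →
      |∫ v', avgKernel β (orthoTube L u v) (orthoTube L u' v') * Ω (linkEmbed L v') ∂orthoTransverse L| ≤ X * CΩ * P := by
    intro v h1
    calc |∫ v', avgKernel β (orthoTube L u v) (orthoTube L u' v') * Ω (linkEmbed L v') ∂orthoTransverse L|
        ≤ ∫ v', |avgKernel β (orthoTube L u v) (orthoTube L u' v') * Ω (linkEmbed L v')| ∂orthoTransverse L := abs_integral_le_integral_abs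
      _ ≤ ∫ _v', X * CΩ ∂orthoTransverse L := by
          refine integral_mono_of_nonneg (ae_of_all _ fun _ => abs_nonneg _) (integrable_const _) (ae_of_all _ fun v' => ?_)
          show |avgKernel β (orthoTube L u v) (orthoTube L u' v') * Ω (linkEmbed L v')| ≤ X * CΩ
          rw [abs_mul, abs_of_pos (avgKernel_pos β _ _)]
          by_cases h2 : Ω (linkEmbed L v') = 0
          · rw [h2, abs_zero, mul_zero]; positivity
          · exact mul_le_mul (hK v v' h1 h2) (hCΩ _) (abs_nonneg _) hX0
      _ = X * CΩ * P := by rw [integral_const, smul_eq_mul, hP]; ring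
  unfold boKernel
  calc |∫ v, Ω (linkEmbed L v) * ∫ v', avgKernel β (orthoTube L u v) (orthoTube L u' v') * Ω (linkEmbed L v') ∂orthoTransverse L ∂orthoTransverse L|
      ≤ ∫ v, |Ω (linkEmbed L v) * ∫ v', avgKernel β (orthoTube L u v) (orthoTube L u' v') * Ω (linkEmbed L v') ∂orthoTransverse L| ∂orthoTransverse L :=
        abs_integral_le_integral_abs
    _ ≤ ∫ _v, CΩ * (X * CΩ * P) ∂orthoTransverse L := by
        refine integral_mono_of_nonneg (ae_of_all _ fun _ => abs_nonneg _) (integrable_const _) (ae_of_all _ fun v => ?_)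
        show |Ω (linkEmbed L v) * ∫ v', avgKernel β (orthoTube L u v) (orthoTube L u' v') * Ω (linkEmbed L v') ∂orthoTransverse L| ≤ CΩ * (X * CΩ * P)
        rw [abs_mul]
        by_cases h1 : Ω (linkEmbed L v) = 0
        · rw [h1, abs_zero, zero_mul]; positivity
        · exact mul_le_mul (hCΩ _) (hinner v h1) (abs_nonneg _) hCΩ0
    _ = CΩ ^ 2 * P ^ 2 * X := by rw [integral_const, smul_eq_mul, hP]; ring

end Summit.QuantumFields.YangMills.Theorems.FemtoTransferGap.TwoLattice.ConstTube

end
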